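import Literature.NumberTheory.EllipticCurves.LFunctionPrimeCoeff
import Literature.NumberTheory.EllipticCurves.RootNumberAtkinLehnerSemistableProofs
import Literature.NumberTheory.EllipticCurves.LocalTorsionMultiplicativeProofs
import HarnessLib

/-!
# The `p`-th coefficient of `L(E, s)` at a prime of MULTIPLICATIVE reduction, prime-indexed: `+1` / `−1`, and its offset from the tree's `frobeniusTrace` (Silverman, *AEC*, §C.16, Ex. 8.19(a), Ex. 3.5)

Silverman, *The Arithmetic of Elliptic Curves* (2nd ed. 2009), §C.16 (PDF p. 390) defines the local
factor of `L(E/K, s)` at a finite place as `1 - a_v T + q_v T²` / `1 - T` / `1 + T` / `1` (good /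
split multiplicative / non-split multiplicative / additive), and Exercise 8.19(a) (p. 230) states for
`E / ℚ`: "for all primes `p` its `p`-th coefficient satisfies `c_p = t_p`", `t_p = p + 1 - #Ẽ(𝔽_p)`
counting ALL points of the reduced cubic — `+1` / `−1` at a split / non-split multiplicative prime
(Ex. 3.5, p. 97: `Ẽ_ns(𝔽_p) ≅ 𝔽_pˣ` resp. the norm-one torus, of order `p ∓ 1`). The tree already has
this for Mathlib's `WeierstrassCurve.LFunction` INDEXED BY THE PLACE `v` of `𝓞 ℚ`
(`LFunction_apply_primesEquiv_of_hasSplitMultiplicativeReductionAt`,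
`…_of_hasMultiplicativeReductionAt_of_not_split`, `RootNumberAtkinLehnerSemistableProofs`) and, prime-indexed,
`a_p ≠ 0` / `a_p² = 1` (`LFunction_apply_ne_zero_of_hasMultiplicativeReductionAtPrime`,
`LFunction_prime_pow_of_hasMultiplicativeReductionAtPrime`). This file adds the PRIME-INDEXED values over
the tree's `HasSplitMultiplicativeReductionAtPrime` / `HasMultiplicativeReductionAtPrime` (over `ℚ_[p]`,
the currency of the cell's class predicates and integer-model toolkits) and the exact OFFSET from the
tree's `frobeniusTrace`:

* `LFunction_apply_prime_of_hasSplitMultiplicativeReductionAtPrime`: `W.LFunction p = 1`;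
* `LFunction_apply_prime_of_hasMultiplicativeReductionAtPrime_of_not_split`: `W.LFunction p = -1`;
* `LFunction_apply_prime_eq_one_iff_hasSplitMultiplicativeReductionAtPrime` (at a multiplicative `p`);
* `LFunction_apply_prime_eq_frobeniusTrace_sub_one_of_hasMultiplicativeReductionAtPrime`: for a globally
  minimal `W`, `W.LFunction p = W.frobeniusTrace p - 1` — the tree's `frobeniusTrace W p = p + 1 - #Ẽ_ns(𝔽_p)`
  (`GlobalMinimalModel`; Mathlib's point type omits the node) is `2` / `0` at a split / non-split
  multiplicative prime (`LocalTorsionMult.reductionPointCount_of_mult`), one more than the Hasse–Weil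
  coefficient. At a prime of good reduction the two agree (`LFunction_apply_prime_eq_frobeniusTrace`).

Why now (cell `b2b-bsdres`, 2026-08-27): the cited-facts audit's register R-20
(`KO92-Prop4-(ii)b-frobeniusTrace-offset`, sheet `pub/bsd-cited/sheets/D-AUDIT-r07-Q41-KO92-LS18.md`) found
Kraus–Oesterlé's Prop. 4 (ii) clause "`a_ℓ a'_ℓ ≡ ℓ + 1 (mod p)`" typed over `frobeniusTrace`; the repair
states it over `W.LFunction ℓ`. The offset theorem is that finding as a kernel identity, and it is what a
kernel discharge of such a clause needs: `LFunction` is not computable in the kernel, `frobeniusTrace` is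
(point counts on the integer model, as in the cell's `card_*` lemmas).

## References

* J. H. Silverman, *The Arithmetic of Elliptic Curves*, GTM 106, 2nd ed., Springer 2009: §C.16
  (definition of `L_v(T)`, PDF p. 390); Exercise 8.19(a) (p. 230); Exercise 3.5 (p. 97);
  VII.5 Prop. 5.1(b), VII.1 Prop. 1.3(b) (the transports `ℚ_[p]` ↔ `𝓞_v`). [cite: SilvermanAEC2009]
-/

noncomputable section

namespace WeierstrassCurve

open ArithmeticFunction IsDedekindDomain NumberField Rat.HeightOneSpectrum
  Literature.NumberTheory.EllipticCurves

variable (W : WeierstrassCurve ℚ) [W.IsElliptic]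

/-- **Silverman Ex. 8.19(a) at a SPLIT multiplicative prime, prime-indexed: `a_p = +1`** — for Mathlib's
`WeierstrassCurve.LFunction` and the tree's `HasSplitMultiplicativeReductionAtPrime` (over `ℚ_[p]`): the
place-indexed `LFunction_apply_primesEquiv_of_hasSplitMultiplicativeReductionAt` at the place `v` of `𝓞 ℚ`
over `p`, through the transport `hasSplitMultiplicativeReductionAtPrime_iff_hasSplitMultiplicativeReductionAt`
(Silverman VII.5.1(b) with VII.1.3(b)). [cite: SilvermanAEC2009, Exercise 8.19(a) (p. 230) and §C.16 (PDF p. 390)] -/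
theorem LFunction_apply_prime_of_hasSplitMultiplicativeReductionAtPrime (p : ℕ) [Fact p.Prime]
    (hs : W.HasSplitMultiplicativeReductionAtPrime p) : W.LFunction p = 1 := by
  obtain ⟨v, rfl⟩ : ∃ v : HeightOneSpectrum (𝓞 ℚ), (primesEquiv v : ℕ) = p :=
    ⟨primesEquiv.symm ⟨p, Fact.out⟩, by rw [Equiv.apply_symm_apply]⟩
  exact W.LFunction_apply_primesEquiv_of_hasSplitMultiplicativeReductionAt
    ((hasSplitMultiplicativeReductionAtPrime_iff_hasSplitMultiplicativeReductionAt W v).mp hs)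

/-- **Silverman Ex. 8.19(a) at a NON-SPLIT multiplicative prime, prime-indexed: `a_p = −1`** (place-indexed
`LFunction_apply_primesEquiv_of_hasMultiplicativeReductionAt_of_not_split` through the transports
`hasMultiplicativeReductionAtPrime_iff_hasMultiplicativeReductionAt_ringOfIntegers` and
`hasSplitMultiplicativeReductionAtPrime_iff_hasSplitMultiplicativeReductionAt`).
[cite: SilvermanAEC2009, Exercise 8.19(a) (p. 230) and §C.16 (PDF p. 390)] -/
theorem LFunction_apply_prime_of_hasMultiplicativeReductionAtPrime_of_not_split (p : ℕ) [Fact p.Prime]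
    (hm : W.HasMultiplicativeReductionAtPrime p) (hns : ¬ W.HasSplitMultiplicativeReductionAtPrime p) :
    W.LFunction p = -1 := by
  obtain ⟨v, rfl⟩ : ∃ v : HeightOneSpectrum (𝓞 ℚ), (primesEquiv v : ℕ) = p :=
    ⟨primesEquiv.symm ⟨p, Fact.out⟩, by rw [Equiv.apply_symm_apply]⟩
  exact W.LFunction_apply_primesEquiv_of_hasMultiplicativeReductionAt_of_not_split
    ((hasMultiplicativeReductionAtPrime_iff_hasMultiplicativeReductionAt_ringOfIntegers W v).mp hm)
    (fun h ↦ hns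
      ((hasSplitMultiplicativeReductionAtPrime_iff_hasSplitMultiplicativeReductionAt W v).mpr h))

/-- **At a multiplicative prime, `a_p = 1` iff the reduction is split** (`+1` split / `−1` non-split).
[cite: SilvermanAEC2009, §C.16 (definition of L_v(T)), PDF p. 390] -/
theorem LFunction_apply_prime_eq_one_iff_hasSplitMultiplicativeReductionAtPrime (p : ℕ) [Fact p.Prime]
    (hm : W.HasMultiplicativeReductionAtPrime p) :
    W.LFunction p = 1 ↔ W.HasSplitMultiplicativeReductionAtPrime p := by
  refine ⟨fun h ↦ ?_, W.LFunction_apply_prime_of_hasSplitMultiplicativeReductionAtPrime p⟩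
  by_contra hns
  rw [W.LFunction_apply_prime_of_hasMultiplicativeReductionAtPrime_of_not_split p hm hns] at h
  norm_num at h

/-- **The offset between the two currencies at a multiplicative prime**: for a globally minimal `W / ℚ`
and a prime `p` of multiplicative reduction, the Hasse–Weil coefficient `W.LFunction p` (`= ±1`;
Silverman Ex. 8.19(a): `t_p` counts ALL points of the reduced cubic) equals the tree's `frobeniusTrace W p`
(`= p + 1 - #Ẽ_ns(𝔽_p)`, the node omitted: `= 2` split / `= 0` non-split,
`LocalTorsionMult.reductionPointCount_of_mult`, Silverman Ex. 3.5) MINUS ONE. (At a prime of good reduction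
they agree: `LFunction_apply_prime_eq_frobeniusTrace`.)
[cite: SilvermanAEC2009, Exercise 8.19(a) (p. 230), §C.16 (PDF p. 390) and Exercise 3.5 (PDF p. 97)] -/
theorem LFunction_apply_prime_eq_frobeniusTrace_sub_one_of_hasMultiplicativeReductionAtPrime
    [W.IsGloballyMinimal] (p : ℕ) [Fact p.Prime] (hm : W.HasMultiplicativeReductionAtPrime p) :
    W.LFunction p = W.frobeniusTrace p - 1 := by
  obtain ⟨hsp, hnsp⟩ := LocalTorsionMult.reductionPointCount_of_mult W p hm
  by_cases hs : W.HasSplitMultiplicativeReductionAtPrime p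
  · rw [W.LFunction_apply_prime_of_hasSplitMultiplicativeReductionAtPrime p hs, frobeniusTrace]
    have : (reductionPointCount W p : ℤ) + 1 = p := by exact_mod_cast hsp hs
    omega
  · rw [W.LFunction_apply_prime_of_hasMultiplicativeReductionAtPrime_of_not_split p hm hs, frobeniusTrace]
    have : (reductionPointCount W p : ℤ) = p + 1 := by exact_mod_cast hnsp hs
    omega

/-- **The Hasse–Weil coefficient at a multiplicative prime is never the tree's `frobeniusTrace`** (they
differ by one) — the kernel form of the cited-facts audit's finding that a congruence clause typed over
`frobeniusTrace` at such a prime is not the printed clause over `a_p`.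
[cite: SilvermanAEC2009, Exercise 8.19(a) (p. 230) and Exercise 3.5 (PDF p. 97)] -/
theorem LFunction_apply_prime_ne_frobeniusTrace_of_hasMultiplicativeReductionAtPrime
    [W.IsGloballyMinimal] (p : ℕ) [Fact p.Prime] (hm : W.HasMultiplicativeReductionAtPrime p) :
    W.LFunction p ≠ W.frobeniusTrace p := by
  rw [W.LFunction_apply_prime_eq_frobeniusTrace_sub_one_of_hasMultiplicativeReductionAtPrime p hm]
  omega

end WeierstrassCurve

end
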